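import Mathlib
import HarnessLib
import Summits.ResolutionOfSingularities.ResolutionOfSingularities.Theorems.HomologicalConductorPersistenceRecurrenceExclusion
import Summits.ResolutionOfSingularities.ResolutionOfSingularities.Theorems.HomologicalConductorPersistenceTraceCriterion
import Summits.ResolutionOfSingularities.ResolutionOfSingularities.Theorems.HomologicalConductorPersistenceSurfaceHullCover

/-!
# Ω-recurrence certificates, rank one: a RECURRENT divisorial ideal bounds `ca(R)` by its trace ideal
# `𝔞·𝔞⁻¹` at ALL levels

Route `ResolutionOfSingularities/HomologicalConductor`, chain W4.4b, rung S-2 `PersistenceSurface`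
(stmt-ResolutionOfSingularities-19970); seat res-L1-w44b-stub-2 (gen 5), row «Ω-recurrence certificates —
kernel shape».  [OURS · L1 w44b; AI-written, weaker than expert review; NOT a statement of the manuscript
under study (Hironaka 2017), and no statement of that manuscript is used.]

The chain's RANK-ONE CEILINGS (tri-2 CENSUS-TORIC, stub-1 `RankOneCeiling`, the class-group batteries at
`T₁(Z13)`, `T₂` of SD-K1) read: "`x ∉ 𝔞·𝔞⁻¹` for a divisorial ideal `𝔞` that is an `s`-th syzygy ⇒
`x ∉ caˢ⁺¹`" (`…PersistenceTraceCriterion.mem_mul_inv_of_mem_cohomologyAnnihilatorOfDegree_of_isSyzygy`),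
a LEVEL-WISE statement; every such ceiling in a non-Gorenstein census cell carries the proviso "`𝔞`
recurrent" before it says anything about the full `ca = ⋃ₙ caⁿ` (CHAIN v13.14 §V13.22.3 LABEL RULE,
plan-1 SEAT PLAN 17:13:05Z).  This file discharges the proviso in the kernel, over
`…PersistenceRecurrenceExclusion` (recurrent classes) and `…PersistenceTraceCriterion` (trace criterion):

* `stablyAnnihilates_ideal_iff_mem_mul_inv` — bridge: for a nonzero ideal `𝔞` of a domain,
  `x ∈ s̲ann(𝔞)` iff `x ∈ 𝔞·𝔞⁻¹`;
* **`algebraMap_mem_mul_inv_of_mem_cohomologyAnnihilator_of_retract_isSyzygy`** — `R` a noetherian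
  domain, `𝔞 ≠ 0` an ideal which (as a module) is a retract of a `p`-th syzygy module of itself, `p ≥ 1`
  (an Ω-RECURRENT divisorial ideal; e.g. `Ω²𝔞 ≅ 𝔞 ⊕ 𝔞'`): then `ca(R) ⊆ 𝔞·𝔞⁻¹` — the rank-one ceiling
  at ALL levels; contrapositive `not_mem_cohomologyAnnihilatorOfDegree_of_not_mem_mul_inv_of_retract_isSyzygy`:
  `x ∉ 𝔞·𝔞⁻¹` ⇒ `x ∉ caᵐ(R)` for every `m`;
* class form `algebraMap_mem_mul_inv_of_mem_cohomologyAnnihilator_of_recurrent` — the same for every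
  nonzero ideal belonging (as a module) to a recurrent class `𝒞` (every member finitely generated and a
  retract of a first syzygy module of a member: the shape of a class-group / «`S₃ ⊆ S₄`» certificate), and
  `cohomologyAnnihilator_le_iInf_comap_mul_inv_of_recurrent` — `ca(R) ⊆ ⋂_{𝔞 ∈ 𝒞} 𝔞·𝔞⁻¹`, the
  modelling step «`ca(T) ⊆ ⋂_{j recurrent} M_j·M_{-j}`» of the toric scans as a theorem.

References (mechanism only): S. B. Iyengar, R. Takahashi, IMRN 2016, arXiv:1404.1476, §2
[`IyengarTakahashi2014`].
-/

noncomputable section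

-- single-problem summit: the doubled namespace component `ResolutionOfSingularities` is forced
set_option linter.dupNamespace false

namespace Summit.ResolutionOfSingularities.ResolutionOfSingularities.Theorems.HomologicalConductor.RecurrenceTraceCeiling

open CategoryTheory CategoryTheory.Abelian Literature.RingTheory.CohomologyAnnihilator
open scoped nonZeroDivisors
open Summit.ResolutionOfSingularities.ResolutionOfSingularities.Theorems.NoZeno.SandwichCluster
open Summit.ResolutionOfSingularities.ResolutionOfSingularities.Theorems.HomologicalConductor.RecurrenceExclusion
open Summit.ResolutionOfSingularities.ResolutionOfSingularities.Theorems.HomologicalConductor.PersistenceTraceCriterion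
open Summit.ResolutionOfSingularities.ResolutionOfSingularities.Theorems.HomologicalConductor.PersistenceSurfaceHullCover

universe u

variable {R : Type u} [CommRing R] [IsDomain R] {K : Type u} [Field K] [Algebra R K] [IsFractionRing R K]

/-- **Bridge**: for a nonzero ideal `𝔞` of a domain, `x` stably annihilates `𝔞` (the homothety factors
through a finitely generated projective, equivalently a finite free module) iff `x` lies in the trace
ideal `𝔞·𝔞⁻¹`. [folklore] -/
theorem stablyAnnihilates_ideal_iff_mem_mul_inv (I : Ideal R) (hI : I ≠ ⊥) (x : R) :
    StablyAnnihilates R x (ModuleCat.of R ↥I) ↔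
      algebraMap R K x ∈ (I : FractionalIdeal R⁰ K) * (I : FractionalIdeal R⁰ K)⁻¹ := by
  rw [stablyAnnihilates_iff_exists_linearMap, ← exists_factor_iff_mem_mul_inv I hI x]
  constructor
  · rintro ⟨s, ι, π, h⟩
    exact ⟨s, ι, π, fun a => by simpa using LinearMap.congr_fun h a⟩
  · rintro ⟨n, ι, π, h⟩
    exact ⟨n, ι, π, LinearMap.ext fun a => by simpa using h a⟩

variable (K)

/-- **THE RECURRENT RANK-ONE CEILING.** `R` a noetherian domain, `𝔞 ≠ 0` an ideal that (as an
`R`-module) is a retract of a `p`-th syzygy module of itself for some `p ≥ 1` (an Ω-recurrent divisorial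
ideal).  Then `ca(R) ⊆ 𝔞·𝔞⁻¹`: every element of the cohomology annihilator — at ANY level — lies in the
trace ideal of `𝔞`. [folklore] -/
theorem algebraMap_mem_mul_inv_of_mem_cohomologyAnnihilator_of_retract_isSyzygy [IsNoetherianRing R]
    (I : Ideal R) (hI : I ≠ ⊥) {p : ℕ} (hp : 0 < p) {N : ModuleCat.{u} R}
    (hN : IsSyzygy p (ModuleCat.of R ↥I) N) (i : ModuleCat.of R ↥I ⟶ N) (r : N ⟶ ModuleCat.of R ↥I)
    (hir : i ≫ r = 𝟙 _) {x : R} (hx : x ∈ cohomologyAnnihilator R) :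
    algebraMap R K x ∈ (I : FractionalIdeal R⁰ K) * (I : FractionalIdeal R⁰ K)⁻¹ :=
  (stablyAnnihilates_ideal_iff_mem_mul_inv I hI x).mp
    (stablyAnnihilates_of_mem_cohomologyAnnihilator_of_retract_isSyzygy
      (Module.IsNoetherian.finite R _) hp hN i r hir hx)

/-- Contrapositive, level by level: `x ∉ 𝔞·𝔞⁻¹` for an Ω-recurrent nonzero ideal `𝔞` ⇒ `x ∉ caᵐ(R)`
for EVERY `m`. [folklore] -/
theorem not_mem_cohomologyAnnihilatorOfDegree_of_not_mem_mul_inv_of_retract_isSyzygy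
    [IsNoetherianRing R] (I : Ideal R) (hI : I ≠ ⊥) {p : ℕ} (hp : 0 < p) {N : ModuleCat.{u} R}
    (hN : IsSyzygy p (ModuleCat.of R ↥I) N) (i : ModuleCat.of R ↥I ⟶ N) (r : N ⟶ ModuleCat.of R ↥I)
    (hir : i ≫ r = 𝟙 _) {x : R}
    (hx : algebraMap R K x ∉ (I : FractionalIdeal R⁰ K) * (I : FractionalIdeal R⁰ K)⁻¹) (m : ℕ) :
    x ∉ cohomologyAnnihilatorOfDegree R m :=
  fun hxm => hx (algebraMap_mem_mul_inv_of_mem_cohomologyAnnihilator_of_retract_isSyzygy K I hI hp hN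
    i r hir (cohomologyAnnihilatorOfDegree_le m hxm))

/-- The periodic case: `𝔞` is a `p`-th syzygy module of itself (`p ≥ 1`) ⇒ `ca(R) ⊆ 𝔞·𝔞⁻¹`.
[folklore] -/
theorem algebraMap_mem_mul_inv_of_mem_cohomologyAnnihilator_of_isSyzygy_self [IsNoetherianRing R]
    (I : Ideal R) (hI : I ≠ ⊥) {p : ℕ} (hp : 0 < p)
    (hII : IsSyzygy p (ModuleCat.of R ↥I) (ModuleCat.of R ↥I)) {x : R} (hx : x ∈ cohomologyAnnihilator R) :
    algebraMap R K x ∈ (I : FractionalIdeal R⁰ K) * (I : FractionalIdeal R⁰ K)⁻¹ :=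
  algebraMap_mem_mul_inv_of_mem_cohomologyAnnihilator_of_retract_isSyzygy K I hI hp hII (𝟙 _) (𝟙 _)
    (Category.comp_id _) hx

/-! ## Class form: `ca(R) ⊆ ⋂_{𝔞 ∈ 𝒞} 𝔞·𝔞⁻¹` for a recurrent class -/

section Recurrent

variable [IsNoetherianRing R] (𝒞 : ModuleCat.{u} R → Prop)

/-- **Class form**: if a nonzero ideal `𝔞` belongs (as a module) to a RECURRENT class `𝒞` (every
member finitely generated and a retract of a first syzygy module of a member), then `ca(R) ⊆ 𝔞·𝔞⁻¹`.
[folklore] -/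
theorem algebraMap_mem_mul_inv_of_mem_cohomologyAnnihilator_of_recurrent
    (hfin : ∀ X, 𝒞 X → Module.Finite R X)
    (hrec : ∀ X, 𝒞 X → ∃ (Y N : ModuleCat.{u} R) (i : X ⟶ N) (r : N ⟶ X),
      𝒞 Y ∧ IsSyzygy 1 Y N ∧ i ≫ r = 𝟙 X)
    (I : Ideal R) (hI : I ≠ ⊥) (hI𝒞 : 𝒞 (ModuleCat.of R ↥I)) {x : R} (hx : x ∈ cohomologyAnnihilator R) :
    algebraMap R K x ∈ (I : FractionalIdeal R⁰ K) * (I : FractionalIdeal R⁰ K)⁻¹ :=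
  (stablyAnnihilates_ideal_iff_mem_mul_inv I hI x).mp
    (stablyAnnihilates_of_mem_cohomologyAnnihilator_of_recurrent 𝒞 hfin hrec hx hI𝒞)

/-- Contrapositive of the class form, level by level. [folklore] -/
theorem not_mem_cohomologyAnnihilatorOfDegree_of_not_mem_mul_inv_of_recurrent
    (hfin : ∀ X, 𝒞 X → Module.Finite R X)
    (hrec : ∀ X, 𝒞 X → ∃ (Y N : ModuleCat.{u} R) (i : X ⟶ N) (r : N ⟶ X),
      𝒞 Y ∧ IsSyzygy 1 Y N ∧ i ≫ r = 𝟙 X)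
    (I : Ideal R) (hI : I ≠ ⊥) (hI𝒞 : 𝒞 (ModuleCat.of R ↥I)) {x : R}
    (hx : algebraMap R K x ∉ (I : FractionalIdeal R⁰ K) * (I : FractionalIdeal R⁰ K)⁻¹) (m : ℕ) :
    x ∉ cohomologyAnnihilatorOfDegree R m :=
  fun hxm => hx (algebraMap_mem_mul_inv_of_mem_cohomologyAnnihilator_of_recurrent K 𝒞 hfin hrec I hI hI𝒞
    (cohomologyAnnihilatorOfDegree_le m hxm))

/-- **`ca(R) ⊆ ⋂_{𝔞 ∈ 𝒞, 𝔞 ≠ 0} 𝔞·𝔞⁻¹`** (pulled back to `R`) for a recurrent class `𝒞` — the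
modelling step «`ca(T) ⊆ ⋂_{j recurrent} M_j·M_{-j}`» of the toric scans. [folklore] -/
theorem cohomologyAnnihilator_le_iInf_comap_mul_inv_of_recurrent
    (hfin : ∀ X, 𝒞 X → Module.Finite R X)
    (hrec : ∀ X, 𝒞 X → ∃ (Y N : ModuleCat.{u} R) (i : X ⟶ N) (r : N ⟶ X),
      𝒞 Y ∧ IsSyzygy 1 Y N ∧ i ≫ r = 𝟙 X) :
    cohomologyAnnihilator R ≤ ⨅ (I : Ideal R) (_ : I ≠ ⊥) (_ : 𝒞 (ModuleCat.of R ↥I)),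
      (((I : FractionalIdeal R⁰ K) * (I : FractionalIdeal R⁰ K)⁻¹ :
        FractionalIdeal R⁰ K) : Submodule R K).comap (Algebra.linearMap R K) := by
  intro x hx
  simp only [Submodule.mem_iInf, Submodule.mem_comap, Algebra.linearMap_apply]
  intro I hI hI𝒞
  exact algebraMap_mem_mul_inv_of_mem_cohomologyAnnihilator_of_recurrent K 𝒞 hfin hrec I hI hI𝒞 hx

end Recurrent

end Summit.ResolutionOfSingularities.ResolutionOfSingularities.Theorems.HomologicalConductor.RecurrenceTraceCeiling

end
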